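import Literature.MathematicalPhysics.QuantumFieldTheory.ConformalBootstrap3D.PointKernelK34v2Data

/-!
# K34v2 certificate, kernel block file H5: head segments `46 ≤ i < 72` (block-checked ones)

`decide` by kernel reduction (no `native_decide`, no extra axioms) of the block checker
`PCert.hBlockOK` of `PointKernel` on the literal data of `PointKernelK34v2Data` (cells checked corner
or chord by the rule bit); soundness is `PCert.hBlockOK_sound`.  Estimated kernel time 258 s
(6 theorems).
-/

set_option maxRecDepth 100000
set_option maxHeartbeats 0

namespace Literature.MathematicalPhysics.QuantumFieldTheory.ConformalBootstrap3D.PointKernelK34v2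

open Literature.MathematicalPhysics.QuantumFieldTheory.ConformalBootstrap3D.PointKernel

/-- head segments `[46, 62)` pass the kernel evaluator (≈46 s of kernel work). [folklore] -/
theorem hBlock_46 : certK34v2.hBlockOK hsegsK34v2 46 62 JHK34v2 = true := by
  decide +kernel

/-- head segments `[62, 64)` pass the kernel evaluator (≈0 s of kernel work). [folklore] -/
theorem hBlock_62 : certK34v2.hBlockOK hsegsK34v2 62 64 JHK34v2 = true := by
  decide +kernel

/-- head segment `[68, 69)` passes the kernel evaluator (≈45 s of kernel work). [folklore] -/
theorem hBlock_68 : certK34v2.hBlockOK hsegsK34v2 68 69 JHK34v2 = true := by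
  decide +kernel

/-- head segment `[69, 70)` passes the kernel evaluator (≈45 s of kernel work). [folklore] -/
theorem hBlock_69 : certK34v2.hBlockOK hsegsK34v2 69 70 JHK34v2 = true := by
  decide +kernel

/-- head segment `[70, 71)` passes the kernel evaluator (≈45 s of kernel work). [folklore] -/
theorem hBlock_70 : certK34v2.hBlockOK hsegsK34v2 70 71 JHK34v2 = true := by
  decide +kernel

/-- head segment `[71, 72)` passes the kernel evaluator (≈45 s of kernel work). [folklore] -/
theorem hBlock_71 : certK34v2.hBlockOK hsegsK34v2 71 72 JHK34v2 = true := by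
  decide +kernel

end Literature.MathematicalPhysics.QuantumFieldTheory.ConformalBootstrap3D.PointKernelK34v2
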